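import Literature.MathematicalPhysics.QuantumLattice.OrderedIntegralSymmetrization
import Mathlib.MeasureTheory.Group.Measure
import Mathlib.MeasureTheory.Integral.Prod
import HarnessLib

/-!
# Splitting the ordered simplex at a marked time: `∫_{Δ_N(t)} Φ = Σ_{k+j=N} ∫_{Δ_k(a)} ∫_{Δ_j(t−a)} Φ(u, a + u′)`

Topic `MathematicalPhysics/QuantumLattice`; continuation of `OrderedIntegralSymmetrization.lean` (the iterated ordered integral
`orderedIntegral k Φ t` of the Dyson series as the Lebesgue integral over the ordered simplex `Δ_k(t)`, and the symmetrisation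
`I_k Φ t = (k!)⁻¹∫_{[0,t]^k}Φ`).  A TWO-TIME correlation `Tr(e^{-(β-s)H} X e^{-sH} Y)` of a perturbed Gibbs state carries two Dyson
series whose product has, in order `N`, the pairs `(k, j)`, `k + j = N`, of ordered integrals over `Δ_k` and `Δ_j` (Bratteli–Robinson II
§5.4.1; `DysonTwoTimeExpansion.lean`); on the functional-integral side the same order carries ONE integral over `[0,β]^N` of a symmetric
integrand.  The passage between the two is the split of the ordered simplex `Δ_N(t) = {0 ≤ w₀ ≤ ⋯ ≤ w_{N-1} ≤ t}` at a marked time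
`a ∈ [0,t]` according to the number `k` of coordinates below `a`:

* (private) `Δ_N(t)` is the disjoint union over `k ≤ N` of the pieces
  `P_k = {w ∈ Δ_N(t) : w_i < a (i < k), a ≤ w_i (i ≥ k)}`;
* `setIntegral_markedPiece_eq` — `∫_{P_k} Φ = ∫_{u ∈ Δ_k(a)} ∫_{u′ ∈ Δ_j(t−a)} Φ(u ⧺ (a + u′))` (`k + j = N`; the merge map
  `(u, u′) ↦ u ⧺ (a + u′)` is a volume-preserving measurable equivalence `ℝ^k × ℝ^j ≃ ℝ^N` — coordinate regrouping and a translation —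
  whose preimage of `P_k` is `Δ_k(a) × Δ_j(t−a)` up to the null set `{u_{k-1} = a}`; then Fubini);
* **`setIntegral_orderedSimplex_eq_sum_marked`** — `∫_{Δ_N(t)} Φ = Σ_{k+j=N} ∫_{Δ_k(a)} ∫_{Δ_j(t−a)} Φ(u ⧺ (a + u′))`;
* `setIntegral_markedPiece_eq_of_integrableOn`, **`setIntegral_orderedSimplex_eq_sum_marked_of_integrableOn`** — the same for merely
  INTEGRABLE integrands (set-integral form; the functional-integral side jumps at coinciding times);
* **`orderedIntegral_eq_sum_marked`** — the same for the iterated integrals: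
  `I_N Φ t = Σ_{k+j=N} I_k (u ↦ I_j (u′ ↦ Φ(u ⧺ (a + u′))) (t − a)) a` for continuous `Φ` and `0 ≤ a ≤ t`.

Everything is PROVED; no definition is introduced (the simplex, the pieces and the merge map are written out; the sum over `k + j = N` is
indexed by `Finset.antidiagonal N`, the summand guarded by `k + j = N`).

## Mathlib / tree search

Mathlib: `MeasurableEquiv.sumPiEquivProdPi`, `MeasurableEquiv.piCongrLeft` + `volume_measurePreserving_*`, `measurePreserving_add_left`,
`Measure.pi_hyperplane` (null hyperplanes), `integral_biUnion_finset`, `setIntegral_prod`, `continuous_parametric_integral_of_continuous`.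
Tree: `orderedIntegral_eq_setIntegral_simplex`, `isCompact_simplex`, `measurableSet_simplex` (`OrderedIntegralSymmetrization`).

## References

* O. Bratteli, D. W. Robinson, *Operator Algebras and Quantum Statistical Mechanics II*, 2nd ed. (Springer 1997), §5.4.1 (perturbation
  expansions of KMS states and their correlation functions). [BratteliRobinsonII1997]
* O. Bratteli, D. W. Robinson, *Operator Algebras and Quantum Statistical Mechanics I*, 2nd ed. (1987), Thm. 3.1.33 and the remark following it
  (time-ordered integrals). [BratteliRobinsonI1987]
-/

noncomputable section

open MeasureTheory Set Filter Topology Finset.Nat Function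
open scoped Nat

namespace Literature.MathematicalPhysics.QuantumLattice

variable {E : Type*} [NormedAddCommGroup E] [NormedSpace ℝ E] [CompleteSpace E]

/-! ### The merge map `(u, u′) ↦ u ⧺ (a + u′)` as a volume-preserving measurable equivalence -/

section Merge

variable (k j : ℕ)

/-- The coordinate regrouping `ℝ^k × ℝ^j ≃ᵐ ℝ^{k+j}`, `(u, v) ↦ u ⧺ v`, is a volume-preserving measurable equivalence. [folklore] -/
private theorem exists_appendEquiv :
    ∃ T : (Fin k → ℝ) × (Fin j → ℝ) ≃ᵐ (Fin (k + j) → ℝ),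
      MeasurePreserving T volume volume ∧ ∀ p, T p = Fin.append p.1 p.2 := by
  set e : Fin k ⊕ Fin j ≃ Fin (k + j) := finSumFinEquiv with he
  set T₁ := (MeasurableEquiv.sumPiEquivProdPi (fun _ : Fin k ⊕ Fin j => ℝ)).symm with hT₁
  set T₂ := MeasurableEquiv.piCongrLeft (fun _ : Fin (k + j) => ℝ) e with hT₂
  refine ⟨T₁.trans T₂, ?_, fun p => ?_⟩
  · exact (volume_measurePreserving_piCongrLeft (fun _ : Fin (k + j) => ℝ) e).comp
      (volume_measurePreserving_sumPiEquivProdPi_symm (fun _ : Fin k ⊕ Fin j => ℝ))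
  · funext i
    rw [MeasurableEquiv.trans_apply]
    refine Fin.addCases (fun i₁ => ?_) (fun i₂ => ?_) i
    · have h1 : (Fin.castAdd j i₁ : Fin (k + j)) = e (Sum.inl i₁) := by rw [he, finSumFinEquiv_apply_left]
      rw [Fin.append_left, h1, hT₂, MeasurableEquiv.coe_piCongrLeft, hT₁, MeasurableEquiv.coe_sumPiEquivProdPi_symm]
      exact Equiv.piCongrLeft_sumInl (fun _ : Fin (k + j) => ℝ) e p.1 p.2 i₁
    · have h2 : (Fin.natAdd k i₂ : Fin (k + j)) = e (Sum.inr i₂) := by rw [he, finSumFinEquiv_apply_right]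
      rw [Fin.append_right, h2, hT₂, MeasurableEquiv.coe_piCongrLeft, hT₁, MeasurableEquiv.coe_sumPiEquivProdPi_symm]
      exact Equiv.piCongrLeft_sumInr (fun _ : Fin (k + j) => ℝ) e p.1 p.2 i₂

/-- **The merge map** `(u, u′) ↦ u ⧺ (a + u′)` is a volume-preserving measurable equivalence `ℝ^k × ℝ^j ≃ᵐ ℝ^{k+j}`
(coordinate regrouping after the translation `u′ ↦ a + u′`, both volume preserving). [folklore] -/
private theorem exists_mergeEquiv (a : ℝ) :
    ∃ S : (Fin k → ℝ) × (Fin j → ℝ) ≃ᵐ (Fin (k + j) → ℝ),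
      MeasurePreserving S volume volume ∧ ∀ p, S p = Fin.append p.1 (fun l => a + p.2 l) := by
  obtain ⟨T, hT, hTapp⟩ := exists_appendEquiv k j
  set sh : (Fin k → ℝ) × (Fin j → ℝ) ≃ᵐ (Fin k → ℝ) × (Fin j → ℝ) :=
    MeasurableEquiv.prodCongr (MeasurableEquiv.refl _) (MeasurableEquiv.addLeft (fun _ : Fin j => a)) with hsh
  have hshmp : MeasurePreserving sh volume volume := by
    rw [show (volume : Measure ((Fin k → ℝ) × (Fin j → ℝ))) = (volume : Measure (Fin k → ℝ)).prod volume from rfl]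
    exact (MeasurePreserving.id volume).prod (measurePreserving_add_left (volume : Measure (Fin j → ℝ)) (fun _ : Fin j => a))
  refine ⟨sh.trans T, hT.comp hshmp, fun p => ?_⟩
  rw [MeasurableEquiv.trans_apply, hTapp]
  rfl

end Merge

/-! ### The pieces of the ordered simplex marked at `a` -/

section Pieces

variable (N : ℕ) (t a : ℝ)

/-- A monotone `w ∈ Δ_N(t)` lies in the piece indexed by `k = #{i : w_i < a}`: the pieces COVER the simplex. [folklore] -/
private theorem exists_mem_markedPiece {w : Fin N → ℝ} (hw : w ∈ {w : Fin N → ℝ | (∀ i, w i ∈ Icc (0 : ℝ) t) ∧ Monotone w}) :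
    ∃ k ∈ Finset.range (N + 1), w ∈ {w : Fin N → ℝ | ((∀ i, w i ∈ Icc (0 : ℝ) t) ∧ Monotone w) ∧
      (∀ i : Fin N, (i : ℕ) < k → w i < a) ∧ (∀ i : Fin N, k ≤ (i : ℕ) → a ≤ w i)} := by
  classical
  set S : Finset (Fin N) := Finset.univ.filter fun i => w i < a with hS
  have hmemS : ∀ i, i ∈ S ↔ w i < a := fun i => by simp [hS]
  -- `S` is a lower set
  have hlower : ∀ i i', i' ≤ i → i ∈ S → i' ∈ S := fun i i' hii' hi =>
    (hmemS i').2 ((hw.2 hii').trans_lt ((hmemS i).1 hi))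
  have hA : ∀ i, i ∉ S → S.card ≤ (i : ℕ) := by
    intro i hi
    have hsub : S ⊆ Finset.Iio i := by
      intro i' hi'
      rw [Finset.mem_Iio]
      by_contra h
      exact hi (hlower i' i (not_lt.1 h) hi')
    simpa only [Fin.card_Iio] using Finset.card_le_card hsub
  have hB : ∀ i, i ∈ S → (i : ℕ) < S.card := by
    intro i hi
    have hsub : Finset.Iic i ⊆ S := fun i' hi' => hlower i i' (Finset.mem_Iic.1 hi') hi
    have := Finset.card_le_card hsub
    rw [Fin.card_Iic] at this
    omega
  refine ⟨S.card, Finset.mem_range.2 (Nat.lt_succ_of_le ?_), hw, fun i hi => ?_, fun i hi => ?_⟩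
  · simpa only [Finset.card_univ, Fintype.card_fin] using Finset.card_le_univ S
  · by_contra h
    exact absurd hi (not_lt.2 (hA i (fun hS' => h ((hmemS i).1 hS'))))
  · by_contra h
    exact absurd (hB i ((hmemS i).2 (not_le.1 h))) (not_lt.2 hi)

/-- **The ordered simplex is the union of its marked pieces.** [folklore] -/
private theorem orderedSimplex_eq_biUnion_markedPiece :
    {w : Fin N → ℝ | (∀ i, w i ∈ Icc (0 : ℝ) t) ∧ Monotone w} =
      ⋃ k ∈ Finset.range (N + 1), {w : Fin N → ℝ | ((∀ i, w i ∈ Icc (0 : ℝ) t) ∧ Monotone w) ∧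
        (∀ i : Fin N, (i : ℕ) < k → w i < a) ∧ (∀ i : Fin N, k ≤ (i : ℕ) → a ≤ w i)} := by
  ext w
  simp only [mem_iUnion, exists_prop]
  constructor
  · intro hw
    exact exists_mem_markedPiece N t a hw
  · rintro ⟨k, -, hk⟩
    exact hk.1

/-- The marked pieces are pairwise disjoint. [folklore] -/
private theorem pairwiseDisjoint_markedPiece :
    Set.Pairwise (↑(Finset.range (N + 1)) : Set ℕ)
      (Disjoint on fun k => {w : Fin N → ℝ | ((∀ i, w i ∈ Icc (0 : ℝ) t) ∧ Monotone w) ∧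
        (∀ i : Fin N, (i : ℕ) < k → w i < a) ∧ (∀ i : Fin N, k ≤ (i : ℕ) → a ≤ w i)}) := by
  -- the piece with fewer coordinates below `a` is disjoint from the one with more
  have key : ∀ k k' : ℕ, k' < N + 1 → k < k' →
      Disjoint {w : Fin N → ℝ | ((∀ i, w i ∈ Icc (0 : ℝ) t) ∧ Monotone w) ∧
          (∀ i : Fin N, (i : ℕ) < k → w i < a) ∧ (∀ i : Fin N, k ≤ (i : ℕ) → a ≤ w i)}
        {w : Fin N → ℝ | ((∀ i, w i ∈ Icc (0 : ℝ) t) ∧ Monotone w) ∧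
          (∀ i : Fin N, (i : ℕ) < k' → w i < a) ∧ (∀ i : Fin N, k' ≤ (i : ℕ) → a ≤ w i)} := by
    intro k k' hk' hlt
    refine Set.disjoint_left.2 fun w hw hw' => ?_
    have hkN : k < N := by omega
    have h1 : a ≤ w ⟨k, hkN⟩ := hw.2.2 ⟨k, hkN⟩ le_rfl
    have h2 : w ⟨k, hkN⟩ < a := hw'.2.1 ⟨k, hkN⟩ hlt
    exact absurd h1 (not_le.2 h2)
  intro k hk k' hk' hne
  rw [Finset.coe_range, Set.mem_Iio] at hk hk'
  rcases lt_or_gt_of_ne hne with hlt | hlt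
  · exact key k k' hk' hlt
  · exact (key k' k hk hlt).symm

/-- The marked pieces are measurable. [folklore] -/
private theorem measurableSet_markedPiece (k : ℕ) :
    MeasurableSet {w : Fin N → ℝ | ((∀ i, w i ∈ Icc (0 : ℝ) t) ∧ Monotone w) ∧
      (∀ i : Fin N, (i : ℕ) < k → w i < a) ∧ (∀ i : Fin N, k ≤ (i : ℕ) → a ≤ w i)} := by
  have h1 : MeasurableSet {w : Fin N → ℝ | ∀ i : Fin N, (i : ℕ) < k → w i < a} := by
    rw [setOf_forall]
    refine MeasurableSet.iInter fun i => ?_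
    by_cases hi : (i : ℕ) < k
    · simp only [hi, true_implies]
      exact measurableSet_lt (measurable_pi_apply i) measurable_const
    · simp only [hi, false_implies, setOf_true]
      exact MeasurableSet.univ
  have h2 : MeasurableSet {w : Fin N → ℝ | ∀ i : Fin N, k ≤ (i : ℕ) → a ≤ w i} := by
    rw [setOf_forall]
    refine MeasurableSet.iInter fun i => ?_
    by_cases hi : k ≤ (i : ℕ)
    · simp only [hi, true_implies]
      exact measurableSet_le measurable_const (measurable_pi_apply i)
    · simp only [hi, false_implies, setOf_true]
      exact MeasurableSet.univ
  simpa only [setOf_and] using (measurableSet_simplex N t).inter (h1.inter h2)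

omit [CompleteSpace E] in
/-- **The simplex integral is the sum of the piece integrals** (`Φ` integrable on the simplex). [folklore] -/
private theorem setIntegral_orderedSimplex_eq_sum_markedPiece (Φ : (Fin N → ℝ) → E)
    (hΦ : IntegrableOn Φ {w : Fin N → ℝ | (∀ i, w i ∈ Icc (0 : ℝ) t) ∧ Monotone w} volume) :
    ∫ w in {w : Fin N → ℝ | (∀ i, w i ∈ Icc (0 : ℝ) t) ∧ Monotone w}, Φ w =
      ∑ k ∈ Finset.range (N + 1), ∫ w in {w : Fin N → ℝ | ((∀ i, w i ∈ Icc (0 : ℝ) t) ∧ Monotone w) ∧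
        (∀ i : Fin N, (i : ℕ) < k → w i < a) ∧ (∀ i : Fin N, k ≤ (i : ℕ) → a ≤ w i)}, Φ w := by
  rw [← integral_biUnion_finset (Finset.range (N + 1)) (fun k _ => measurableSet_markedPiece N t a k)
    (pairwiseDisjoint_markedPiece N t a) (fun k _ => hΦ.mono_set (fun w hw => hw.1)),
    ← orderedSimplex_eq_biUnion_markedPiece N t a]

end Pieces

/-! ### The integral over one piece: change of variables by the merge map, then Fubini -/

section PieceIntegral

variable (k j : ℕ) {a t : ℝ}

/-- Membership of a merged point `u ⧺ (a + u′)` in the `k`-th marked piece of `Δ_{k+j}(t)`: `u ∈ Δ_k(a)` with all `u_i < a`, and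
`u′ ∈ Δ_j(t − a)` (`0 ≤ a ≤ t`). [folklore] -/
private theorem append_mem_markedPiece_iff (ha : 0 ≤ a) (hat : a ≤ t) (u : Fin k → ℝ) (u' : Fin j → ℝ) :
    (Fin.append u (fun l => a + u' l) : Fin (k + j) → ℝ) ∈
        {w : Fin (k + j) → ℝ | ((∀ i, w i ∈ Icc (0 : ℝ) t) ∧ Monotone w) ∧
          (∀ i : Fin (k + j), (i : ℕ) < k → w i < a) ∧ (∀ i : Fin (k + j), k ≤ (i : ℕ) → a ≤ w i)} ↔
      (u ∈ {w : Fin k → ℝ | (∀ i, w i ∈ Icc (0 : ℝ) a) ∧ Monotone w} ∧ ∀ i, u i < a) ∧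
        u' ∈ {w : Fin j → ℝ | (∀ i, w i ∈ Icc (0 : ℝ) (t - a)) ∧ Monotone w} := by
  set w : Fin (k + j) → ℝ := Fin.append u (fun l => a + u' l) with hw
  have hwl : ∀ i : Fin k, w (Fin.castAdd j i) = u i := fun i => by rw [hw, Fin.append_left]
  have hwr : ∀ l : Fin j, w (Fin.natAdd k l) = a + u' l := fun l => by rw [hw, Fin.append_right]
  simp only [mem_setOf_eq, mem_Icc]
  constructor
  · rintro ⟨⟨hb, hm⟩, hlt, hge⟩
    have hu : ∀ i, u i < a := fun i => by
      have := hlt (Fin.castAdd j i) (by simp)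
      rwa [hwl] at this
    refine ⟨⟨⟨fun i => ⟨?_, (hu i).le⟩, fun i i' hii' => ?_⟩, hu⟩, fun l => ⟨?_, ?_⟩, fun l l' hll' => ?_⟩
    · have := (hb (Fin.castAdd j i)).1; rwa [hwl] at this
    · have := hm (show Fin.castAdd j i ≤ Fin.castAdd j i' from hii'); rwa [hwl, hwl] at this
    · have := hge (Fin.natAdd k l) (by simp); rw [hwr] at this; linarith
    · have := (hb (Fin.natAdd k l)).2; rw [hwr] at this; linarith
    · have := hm (show Fin.natAdd k l ≤ Fin.natAdd k l' by simpa using hll'); rw [hwr, hwr] at this; linarith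
  · rintro ⟨⟨⟨hub, hum⟩, hu⟩, hu'b, hu'm⟩
    refine ⟨⟨fun i => ?_, ?_⟩, fun i hi => ?_, fun i hi => ?_⟩
    · refine Fin.addCases (fun i₁ => ?_) (fun i₂ => ?_) i
      · rw [hwl]; exact ⟨(hub i₁).1, (hub i₁).2.trans hat⟩
      · rw [hwr]; constructor <;> linarith [(hu'b i₂).1, (hu'b i₂).2]
    · intro p q hpq
      induction p using Fin.addCases with
      | left p₁ =>
        induction q using Fin.addCases with
        | left q₁ =>
          rw [hwl, hwl]
          have hle : (p₁ : ℕ) ≤ q₁ := by have := Fin.le_def.1 hpq; simpa using this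
          exact hum (Fin.le_def.2 hle)
        | right q₂ =>
          rw [hwl, hwr]
          linarith [hu p₁, (hu'b q₂).1]
      | right p₂ =>
        induction q using Fin.addCases with
        | left q₁ =>
          exfalso
          have := Fin.le_def.1 hpq
          simp at this
          omega
        | right q₂ =>
          rw [hwr, hwr]
          have : p₂ ≤ q₂ := by
            have := Fin.le_def.1 hpq
            simp at this
            exact Fin.le_def.2 this
          linarith [hu'm this]
    · induction i using Fin.addCases with
      | left i₁ => rw [hwl]; exact hu i₁
      | right i₂ => simp at hi
    · induction i using Fin.addCases with
      | left i₁ => exact absurd hi (by simp)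
      | right i₂ => rw [hwr]; linarith [(hu'b i₂).1]

/-- A product set with a null-hyperplane first factor is null. [folklore] -/
private theorem volume_prod_hyperplane_eq_zero (i : Fin k) (a : ℝ) :
    volume {p : (Fin k → ℝ) × (Fin j → ℝ) | p.1 i = a} = 0 := by
  have hset : {p : (Fin k → ℝ) × (Fin j → ℝ) | p.1 i = a} = {u : Fin k → ℝ | u i = a} ×ˢ (univ : Set (Fin j → ℝ)) := by
    ext p; simp
  have h0 : volume {u : Fin k → ℝ | u i = a} = 0 := by
    rw [volume_pi]
    exact Measure.pi_hyperplane (fun _ : Fin k => (volume : Measure ℝ)) i a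
  rw [hset, show (volume : Measure ((Fin k → ℝ) × (Fin j → ℝ))) = (volume : Measure (Fin k → ℝ)).prod volume from rfl,
    Measure.prod_prod, h0, zero_mul]

omit [CompleteSpace E] in
/-- **The integral over the `k`-th marked piece of `Δ_{k+j}(t)`** is the double integral over `Δ_k(a) × Δ_j(t − a)` of the merged integrand
(`0 ≤ a ≤ t`, `Φ` continuous). [cite: BratteliRobinsonII1997, §5.4.1] -/
theorem setIntegral_markedPiece_eq (ha : 0 ≤ a) (hat : a ≤ t) (Φ : (Fin (k + j) → ℝ) → E) (hΦ : Continuous Φ) :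
    ∫ w in {w : Fin (k + j) → ℝ | ((∀ i, w i ∈ Icc (0 : ℝ) t) ∧ Monotone w) ∧
        (∀ i : Fin (k + j), (i : ℕ) < k → w i < a) ∧ (∀ i : Fin (k + j), k ≤ (i : ℕ) → a ≤ w i)}, Φ w =
      ∫ u in {w : Fin k → ℝ | (∀ i, w i ∈ Icc (0 : ℝ) a) ∧ Monotone w},
        ∫ u' in {w : Fin j → ℝ | (∀ i, w i ∈ Icc (0 : ℝ) (t - a)) ∧ Monotone w}, Φ (Fin.append u (fun l => a + u' l)) := by
  obtain ⟨S, hS, hSapp⟩ := exists_mergeEquiv k j a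
  set P : Set (Fin (k + j) → ℝ) := {w | ((∀ i, w i ∈ Icc (0 : ℝ) t) ∧ Monotone w) ∧
      (∀ i : Fin (k + j), (i : ℕ) < k → w i < a) ∧ (∀ i : Fin (k + j), k ≤ (i : ℕ) → a ≤ w i)} with hP
  set A : Set (Fin k → ℝ) := {w | (∀ i, w i ∈ Icc (0 : ℝ) a) ∧ Monotone w} with hA
  set B : Set (Fin j → ℝ) := {w | (∀ i, w i ∈ Icc (0 : ℝ) (t - a)) ∧ Monotone w} with hB
  -- change of variables by the merge map
  have key := hS.setIntegral_preimage_emb S.measurableEmbedding Φ P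
  rw [← key]
  simp_rw [hSapp]
  -- the preimage of the piece is the product of the two simplices, up to a null set
  have hsub : S ⁻¹' P ⊆ A ×ˢ B := by
    intro p hp
    rw [mem_preimage, hSapp, hP, append_mem_markedPiece_iff k j ha hat] at hp
    exact ⟨hp.1.1, hp.2⟩
  have hdiff : (A ×ˢ B) \ (S ⁻¹' P) ⊆ ⋃ i : Fin k, {p : (Fin k → ℝ) × (Fin j → ℝ) | p.1 i = a} := by
    rintro ⟨u, u'⟩ ⟨⟨huA, huB⟩, hnot⟩
    rw [mem_preimage, hSapp, hP, append_mem_markedPiece_iff k j ha hat] at hnot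
    have : ¬ ∀ i, u i < a := fun h => hnot ⟨⟨huA, h⟩, huB⟩
    obtain ⟨i, hi⟩ := not_forall.1 this
    exact mem_iUnion.2 ⟨i, le_antisymm (huA.1 i).2 (not_lt.1 hi)⟩
  have hnull : volume (⋃ i : Fin k, {p : (Fin k → ℝ) × (Fin j → ℝ) | p.1 i = a}) = 0 :=
    measure_iUnion_null fun i => volume_prod_hyperplane_eq_zero k j i a
  have hae : S ⁻¹' P =ᵐ[volume] A ×ˢ B := by
    refine ae_eq_set.mpr ⟨?_, measure_mono_null hdiff hnull⟩
    rw [Set.sdiff_eq_empty.mpr hsub, measure_empty]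
  rw [setIntegral_congr_set hae]
  -- Fubini
  have hcont : Continuous fun p : (Fin k → ℝ) × (Fin j → ℝ) => Φ (Fin.append p.1 (fun l => a + p.2 l)) := by
    refine hΦ.comp (continuous_pi fun i => ?_)
    refine Fin.addCases (fun i₁ => ?_) (fun i₂ => ?_) i
    · simp only [Fin.append_left]; exact (continuous_apply i₁).comp continuous_fst
    · simp only [Fin.append_right]; exact continuous_const.add ((continuous_apply i₂).comp continuous_snd)
  have hInt : IntegrableOn (fun p : (Fin k → ℝ) × (Fin j → ℝ) => Φ (Fin.append p.1 (fun l => a + p.2 l))) (A ×ˢ B)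
      ((volume : Measure (Fin k → ℝ)).prod volume) :=
    hcont.continuousOn.integrableOn_compact ((isCompact_simplex k a).prod (isCompact_simplex j (t - a)))
  rw [show (volume : Measure ((Fin k → ℝ) × (Fin j → ℝ))) = (volume : Measure (Fin k → ℝ)).prod volume from rfl,
    setIntegral_prod _ hInt]

end PieceIntegral

/-! ### Assembly: the marked split of the simplex integral and of the ordered integral -/

section Assembly

variable (N : ℕ) {a t : ℝ}

omit [NormedSpace ℝ E] [CompleteSpace E] in
/-- The merged integrand is jointly continuous in `(u, u′)`. [folklore] -/
private theorem continuous_merge_comp {k j : ℕ} (a : ℝ) (Φ : (Fin (k + j) → ℝ) → E) (hΦ : Continuous Φ) :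
    Continuous fun p : (Fin k → ℝ) × (Fin j → ℝ) => Φ (Fin.append p.1 (fun l => a + p.2 l)) := by
  refine hΦ.comp (continuous_pi fun i => ?_)
  refine Fin.addCases (fun i₁ => ?_) (fun i₂ => ?_) i
  · simp only [Fin.append_left]; exact (continuous_apply i₁).comp continuous_fst
  · simp only [Fin.append_right]; exact continuous_const.add ((continuous_apply i₂).comp continuous_snd)

omit [CompleteSpace E] in
/-- **THE MARKED SPLIT OF THE SIMPLEX INTEGRAL.**  For `0 ≤ a ≤ t` and continuous `Φ`:
`∫_{Δ_N(t)} Φ = Σ_{k+j=N} ∫_{u ∈ Δ_k(a)} ∫_{u′ ∈ Δ_j(t−a)} Φ(u ⧺ (a + u′))` (the summand is guarded by `k + j = N`, under which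
`Fin.cast` identifies `Fin (k + j)` with `Fin N`). [cite: BratteliRobinsonII1997, §5.4.1] -/
theorem setIntegral_orderedSimplex_eq_sum_marked (ha : 0 ≤ a) (hat : a ≤ t) (Φ : (Fin N → ℝ) → E) (hΦ : Continuous Φ) :
    ∫ w in {w : Fin N → ℝ | (∀ i, w i ∈ Icc (0 : ℝ) t) ∧ Monotone w}, Φ w =
      ∑ kj ∈ Finset.HasAntidiagonal.antidiagonal N, if h : kj.1 + kj.2 = N then
        ∫ u in {w : Fin kj.1 → ℝ | (∀ i, w i ∈ Icc (0 : ℝ) a) ∧ Monotone w},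
          ∫ u' in {w : Fin kj.2 → ℝ | (∀ i, w i ∈ Icc (0 : ℝ) (t - a)) ∧ Monotone w},
            Φ (fun i => Fin.append u (fun l => a + u' l) (Fin.cast h.symm i))
      else 0 := by
  have hInt : IntegrableOn Φ {w : Fin N → ℝ | (∀ i, w i ∈ Icc (0 : ℝ) t) ∧ Monotone w} volume :=
    hΦ.continuousOn.integrableOn_compact (isCompact_simplex N t)
  rw [setIntegral_orderedSimplex_eq_sum_markedPiece N t a Φ hInt,
    ← Finset.Nat.sum_antidiagonal_eq_sum_range_succ_mk (fun kj : ℕ × ℕ =>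
      ∫ w in {w : Fin N → ℝ | ((∀ i, w i ∈ Icc (0 : ℝ) t) ∧ Monotone w) ∧
        (∀ i : Fin N, (i : ℕ) < kj.1 → w i < a) ∧ (∀ i : Fin N, kj.1 ≤ (i : ℕ) → a ≤ w i)}, Φ w) N]
  refine Finset.sum_congr rfl fun kj hkj => ?_
  have h : kj.1 + kj.2 = N := Finset.HasAntidiagonal.mem_antidiagonal.1 hkj
  rw [dif_pos h]
  obtain ⟨k, j⟩ := kj
  simp only at h ⊢
  subst h
  simp only [Fin.cast_eq_self]
  exact setIntegral_markedPiece_eq k j ha hat Φ hΦ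

/-- **THE MARKED SPLIT OF THE ORDERED INTEGRAL.**  For `0 ≤ a ≤ t` and continuous `Φ`:
`I_N Φ t = Σ_{k+j=N} I_k (u ↦ I_j (u′ ↦ Φ(u ⧺ (a + u′))) (t − a)) a` — the `N` ordered times split into the `k` before the marked time
`a` and the `j` after it, the latter re-parametrised relative to `a`. [cite: BratteliRobinsonII1997, §5.4.1] -/
theorem orderedIntegral_eq_sum_marked (ha : 0 ≤ a) (hat : a ≤ t) (Φ : (Fin N → ℝ) → E) (hΦ : Continuous Φ) :
    orderedIntegral N Φ t =
      ∑ kj ∈ Finset.HasAntidiagonal.antidiagonal N, if h : kj.1 + kj.2 = N then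
        orderedIntegral kj.1 (fun u => orderedIntegral kj.2
          (fun u' => Φ (fun i => Fin.append u (fun l => a + u' l) (Fin.cast h.symm i))) (t - a)) a
      else 0 := by
  rw [orderedIntegral_eq_setIntegral_simplex N Φ hΦ t (ha.trans hat), setIntegral_orderedSimplex_eq_sum_marked N ha hat Φ hΦ]
  refine Finset.sum_congr rfl fun kj hkj => ?_
  have h : kj.1 + kj.2 = N := Finset.HasAntidiagonal.mem_antidiagonal.1 hkj
  rw [dif_pos h, dif_pos h]
  obtain ⟨k, j⟩ := kj
  simp only at h ⊢
  subst h
  simp only [Fin.cast_eq_self]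
  have hcont := continuous_merge_comp a Φ hΦ
  -- the inner integrals
  have hinner : ∀ u : Fin k → ℝ,
      ∫ u' in {w : Fin j → ℝ | (∀ i, w i ∈ Icc (0 : ℝ) (t - a)) ∧ Monotone w}, Φ (Fin.append u (fun l => a + u' l)) =
        orderedIntegral j (fun u' => Φ (Fin.append u (fun l => a + u' l))) (t - a) := fun u =>
    (orderedIntegral_eq_setIntegral_simplex j _ (hcont.comp (continuous_const.prodMk continuous_id)) (t - a)
      (sub_nonneg.2 hat)).symm
  rw [setIntegral_congr_fun (measurableSet_simplex k a) (fun u _ => hinner u)]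
  -- the outer integral
  have houter : Continuous fun u : Fin k → ℝ => orderedIntegral j (fun u' => Φ (Fin.append u (fun l => a + u' l))) (t - a) :=
    continuous_orderedIntegral j (fun u u' => Φ (Fin.append u (fun l => a + u' l))) hcont (fun _ => t - a) continuous_const
  exact (orderedIntegral_eq_setIntegral_simplex k _ houter a ha).symm

end Assembly

/-! ### The marked split for integrable (possibly discontinuous) integrands

The functional-integral side of the two-time matching carries integrands which jump at coinciding times (time-ordered
propagators); for them only integrability on the simplex is available, and the split is stated at the level of SET integrals. -/

section Integrable

variable {a t : ℝ}

omit [CompleteSpace E] in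
/-- **The integral over the `k`-th marked piece, integrable version**: for `Φ` integrable on the piece (and `0 ≤ a ≤ t`),
`∫_{P_k} Φ = ∫_{u ∈ Δ_k(a)} ∫_{u′ ∈ Δ_j(t−a)} Φ(u ⧺ (a + u′))`. [cite: BratteliRobinsonII1997, §5.4.1] -/
theorem setIntegral_markedPiece_eq_of_integrableOn (k j : ℕ) (ha : 0 ≤ a) (hat : a ≤ t) (Φ : (Fin (k + j) → ℝ) → E)
    (hΦ : IntegrableOn Φ {w : Fin (k + j) → ℝ | ((∀ i, w i ∈ Icc (0 : ℝ) t) ∧ Monotone w) ∧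
        (∀ i : Fin (k + j), (i : ℕ) < k → w i < a) ∧ (∀ i : Fin (k + j), k ≤ (i : ℕ) → a ≤ w i)} volume) :
    ∫ w in {w : Fin (k + j) → ℝ | ((∀ i, w i ∈ Icc (0 : ℝ) t) ∧ Monotone w) ∧
        (∀ i : Fin (k + j), (i : ℕ) < k → w i < a) ∧ (∀ i : Fin (k + j), k ≤ (i : ℕ) → a ≤ w i)}, Φ w =
      ∫ u in {w : Fin k → ℝ | (∀ i, w i ∈ Icc (0 : ℝ) a) ∧ Monotone w},
        ∫ u' in {w : Fin j → ℝ | (∀ i, w i ∈ Icc (0 : ℝ) (t - a)) ∧ Monotone w}, Φ (Fin.append u (fun l => a + u' l)) := by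
  obtain ⟨S, hS, hSapp⟩ := exists_mergeEquiv k j a
  set P : Set (Fin (k + j) → ℝ) := {w | ((∀ i, w i ∈ Icc (0 : ℝ) t) ∧ Monotone w) ∧
      (∀ i : Fin (k + j), (i : ℕ) < k → w i < a) ∧ (∀ i : Fin (k + j), k ≤ (i : ℕ) → a ≤ w i)} with hP
  set A : Set (Fin k → ℝ) := {w | (∀ i, w i ∈ Icc (0 : ℝ) a) ∧ Monotone w} with hA
  set B : Set (Fin j → ℝ) := {w | (∀ i, w i ∈ Icc (0 : ℝ) (t - a)) ∧ Monotone w} with hB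
  have key := hS.setIntegral_preimage_emb S.measurableEmbedding Φ P
  rw [← key]
  -- integrability transported through the measure-preserving merge map
  have hIntS : IntegrableOn (fun p => Φ (S p)) (S ⁻¹' P) volume :=
    (hS.integrableOn_comp_preimage S.measurableEmbedding).2 hΦ
  simp_rw [hSapp] at hIntS ⊢
  have hsub : S ⁻¹' P ⊆ A ×ˢ B := by
    intro p hp
    rw [mem_preimage, hSapp, hP, append_mem_markedPiece_iff k j ha hat] at hp
    exact ⟨hp.1.1, hp.2⟩
  have hdiff : (A ×ˢ B) \ (S ⁻¹' P) ⊆ ⋃ i : Fin k, {p : (Fin k → ℝ) × (Fin j → ℝ) | p.1 i = a} := by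
    rintro ⟨u, u'⟩ ⟨⟨huA, huB⟩, hnot⟩
    rw [mem_preimage, hSapp, hP, append_mem_markedPiece_iff k j ha hat] at hnot
    have : ¬ ∀ i, u i < a := fun h => hnot ⟨⟨huA, h⟩, huB⟩
    obtain ⟨i, hi⟩ := not_forall.1 this
    exact mem_iUnion.2 ⟨i, le_antisymm (huA.1 i).2 (not_lt.1 hi)⟩
  have hnull : volume (⋃ i : Fin k, {p : (Fin k → ℝ) × (Fin j → ℝ) | p.1 i = a}) = 0 :=
    measure_iUnion_null fun i => volume_prod_hyperplane_eq_zero k j i a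
  have hae : S ⁻¹' P =ᵐ[volume] A ×ˢ B := by
    refine ae_eq_set.mpr ⟨?_, measure_mono_null hdiff hnull⟩
    rw [Set.sdiff_eq_empty.mpr hsub, measure_empty]
  rw [setIntegral_congr_set hae]
  have hInt : IntegrableOn (fun p : (Fin k → ℝ) × (Fin j → ℝ) => Φ (Fin.append p.1 (fun l => a + p.2 l))) (A ×ˢ B)
      ((volume : Measure (Fin k → ℝ)).prod volume) := by
    rw [show ((volume : Measure (Fin k → ℝ)).prod volume) = (volume : Measure ((Fin k → ℝ) × (Fin j → ℝ))) from rfl]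
    exact hIntS.congr_set_ae hae.symm
  rw [show (volume : Measure ((Fin k → ℝ) × (Fin j → ℝ))) = (volume : Measure (Fin k → ℝ)).prod volume from rfl,
    setIntegral_prod _ hInt]

omit [CompleteSpace E] in
/-- **THE MARKED SPLIT OF THE SIMPLEX INTEGRAL, integrable version.**  For `0 ≤ a ≤ t` and `Φ` integrable on `Δ_N(t)` (no
continuity — e.g. a product of time-ordered propagators):
`∫_{Δ_N(t)} Φ = Σ_{k+j=N} ∫_{u ∈ Δ_k(a)} ∫_{u′ ∈ Δ_j(t−a)} Φ(u ⧺ (a + u′))`. [cite: BratteliRobinsonII1997, §5.4.1] -/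
theorem setIntegral_orderedSimplex_eq_sum_marked_of_integrableOn (N : ℕ) (ha : 0 ≤ a) (hat : a ≤ t) (Φ : (Fin N → ℝ) → E)
    (hΦ : IntegrableOn Φ {w : Fin N → ℝ | (∀ i, w i ∈ Icc (0 : ℝ) t) ∧ Monotone w} volume) :
    ∫ w in {w : Fin N → ℝ | (∀ i, w i ∈ Icc (0 : ℝ) t) ∧ Monotone w}, Φ w =
      ∑ kj ∈ Finset.HasAntidiagonal.antidiagonal N, if h : kj.1 + kj.2 = N then
        ∫ u in {w : Fin kj.1 → ℝ | (∀ i, w i ∈ Icc (0 : ℝ) a) ∧ Monotone w},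
          ∫ u' in {w : Fin kj.2 → ℝ | (∀ i, w i ∈ Icc (0 : ℝ) (t - a)) ∧ Monotone w},
            Φ (fun i => Fin.append u (fun l => a + u' l) (Fin.cast h.symm i))
      else 0 := by
  rw [setIntegral_orderedSimplex_eq_sum_markedPiece N t a Φ hΦ,
    ← Finset.Nat.sum_antidiagonal_eq_sum_range_succ_mk (fun kj : ℕ × ℕ =>
      ∫ w in {w : Fin N → ℝ | ((∀ i, w i ∈ Icc (0 : ℝ) t) ∧ Monotone w) ∧
        (∀ i : Fin N, (i : ℕ) < kj.1 → w i < a) ∧ (∀ i : Fin N, kj.1 ≤ (i : ℕ) → a ≤ w i)}, Φ w) N]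
  refine Finset.sum_congr rfl fun kj hkj => ?_
  have h : kj.1 + kj.2 = N := Finset.HasAntidiagonal.mem_antidiagonal.1 hkj
  rw [dif_pos h]
  obtain ⟨k, j⟩ := kj
  simp only at h ⊢
  subst h
  simp only [Fin.cast_eq_self]
  exact setIntegral_markedPiece_eq_of_integrableOn k j ha hat Φ (hΦ.mono_set fun w hw => hw.1)

end Integrable

end Literature.MathematicalPhysics.QuantumLattice

end
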